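import Literature.Analysis.FluidPDE.Onsager1949
import Literature.Analysis.FluidPDE.OnsagerProofs
import HarnessLib

/-!
# Proof of Onsager's 1949 conservation claim (`Onsager1949_energyConservation`)

Analysis/FluidPDE proofs file: discharges the named fact
`Literature.Analysis.FluidPDE.Onsager1949_energyConservation` (`FluidPDE/Onsager1949`, Onsager 1949,
condition (26) and closing paragraph): a weak solution of incompressible Euler on `T³ × (0,T)`
obeying a Hölder condition `|u(t,x) - u(t,x')| ≤ C d(x,x')ⁿ` with one constant for all
`t ∈ (0,T)` and some `n > 1/3` conserves kinetic energy (a.e. in time). The main result is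
`Literature.Analysis.FluidPDE.Onsager1949_energyConservation_holds`.

## The argument

The analytic core is the Constantin–E–Titi theorem, already proved in the tree
(`Literature.Analysis.FluidPDE.onsager_rigidity_holds`, `FluidPDE/OnsagerProofs`; Hölder form
`onsager_rigidity_holder_of'`, `FluidPDE/Onsager`): weak Euler solutions in `L³(0,T; C^n(T³))`,
`n > 1/3`, conserve energy. What remains is the embedding of Onsager's hypothesis into that
class: a weak Euler solution `u` (an `L²_{t,x}` field) with `[u(t)]_{C^{0,n}} ≤ C` for all
`t ∈ (0,T)` lies in `L³(0,T; C^n(T³))` (indeed in `L^∞_t C^n_x`). The Hölder seminorm is bounded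
by hypothesis; the sup norm is controlled by the spatial mean plus the oscillation
`C · diam(T³)ⁿ`, and the spatial mean `∫_{T³} u(t,x) dx` of a weak Euler solution is a.e.
constant in time: testing the weak formulation with the divergence-free field
`ψ(t,x) = η(t) eᵢ` (`η ∈ C_c^∞(0,T)`, `eᵢ` a coordinate vector, `(u·∇)ψ = 0`) gives
`∫ η'(t) (∫ uᵢ(t,x) dx) dt = 0`, i.e. the mean has vanishing distributional time derivative,
and an integrable function with vanishing distributional derivative on an interval is a.e.
constant (`Literature.Analysis.FunctionSpaces.ae_eq_const_of_forall_setIntegral_deriv_mul_eq_zero`).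
This is conservation of total momentum for weak Euler solutions on the torus, where constant
vector fields are admissible divergence-free test fields (the weak formulation
`Torus.IsWeakNSSolutionOn` does not impose zero mean).

## Contents

* `Onsager1949.isSpaceTimeTestIoo_smul_const`, `Onsager1949.isDivFree_const`,
  `Onsager1949.convect_const`, `Onsager1949.timeDeriv_smul_const`: the test field `η(t) e`.
* `Onsager1949.integrable_uncurry_prod`: an `L²_{t,x}` field on `(0,T) × T^d` is integrable there.
* `Onsager1949.exists_ae_integral_apply_eq_const`: the coordinate means of a weak Euler solution
  are a.e. constant on `(0,T)`.
* `Onsager1949.memLpHolder_of_uniformHolderOn`: Onsager's uniform condition (26) for a weak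
  Euler solution implies `u ∈ L³(0,T; C^n(T³))` (`Literature.Analysis.FunctionSpaces.MemLpHolder 3 n u (Ioo 0 T)`).
* `Onsager1949_energyConservation_holds`: the discharge.

## References

* L. Onsager, *Statistical hydrodynamics*, Nuovo Cimento (9) 6, Suppl. 2 (1949), 279–287,
  condition (26) and the closing paragraph.
* P. Constantin, W. E, E. S. Titi, *Onsager's conjecture on the energy conservation for solutions
  of Euler's equation*, Comm. Math. Phys. 165 (1994), 207–209, Theorem p. 207 and the remark
  following it (Hölder spaces).
* G. L. Eyink, *Energy dissipation without viscosity in ideal hydrodynamics. I. Fourier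
  analysis and local energy transfer*, Physica D 78 (1994), no. 3–4, 222–240.
-/

noncomputable section

open MeasureTheory Set Filter Topology Function
open scoped NNReal ENNReal InnerProductSpace ContDiff

namespace Literature.Analysis.FluidPDE

namespace Onsager1949

/-! ## The test field `ψ(t,x) = η(t) e` -/

section TestField

/-- For `η` smooth, compactly supported with `tsupport η ⊆ (0,T)`, and a constant vector `e`, the
field `ψ(t,x) = η(t) e` is a space–time test field supported in `(0,T)`. [folklore] -/
theorem isSpaceTimeTestIoo_smul_const {d : Type*} [Fintype d] {T : ℝ} (hT : 0 < T) {η : ℝ → ℝ}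
    (hη : ContDiff ℝ ∞ η) (hηc : HasCompactSupport η) (hηs : tsupport η ⊆ Ioo 0 T)
    (e : EuclideanSpace ℝ d) :
    FunctionSpaces.Torus.IsSpaceTimeTestIoo T (fun t (_ : UnitAddTorus d) => η t • e) := by
  obtain ⟨a, b, ha, -, hb, hz⟩ :=
    FunctionSpaces.exists_Icc_subset_Ioo_of_tsupport_subset hT hηc hηs
  have hz' : ∀ t, t ∉ Icc a b → η t = 0 := fun t ht => by
    by_contra h
    exact ht (hz t h)
  refine ⟨⟨?_, (b + T) / 2, by linarith, fun t ht => ?_⟩, a / 2, by linarith, fun t ht => ?_⟩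
  · change ContDiff ℝ ∞ (fun p : ℝ × EuclideanSpace ℝ d => η p.1 • e)
    exact (hη.comp contDiff_fst).smul contDiff_const
  · funext x
    have h0 : η t = 0 := hz' t fun h => by linarith [h.2]
    simp [h0]
  · funext x
    have h0 : η t = 0 := hz' t fun h => by linarith [h.1]
    simp [h0]

/-- Constant vector fields on the torus are divergence free. [folklore] -/
theorem isDivFree_const {d : Type*} [Fintype d] [DecidableEq d] (e : EuclideanSpace ℝ d) :
    FunctionSpaces.Torus.IsDivFree (fun _ : UnitAddTorus d => e) := by
  intro x
  simp [FunctionSpaces.Torus.divergence, FunctionSpaces.Torus.partialDeriv,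
    FunctionSpaces.Torus.lineDeriv]

/-- The convective derivative of a constant field vanishes: `(w·∇) e = 0`. [folklore] -/
theorem convect_const {d : Type*} [Fintype d] (w : UnitAddTorus d → EuclideanSpace ℝ d)
    (e : EuclideanSpace ℝ d) (x : UnitAddTorus d) :
    FunctionSpaces.Torus.convect w (fun _ : UnitAddTorus d => e) x = 0 := by
  have h : FunctionSpaces.Torus.liftAt (fun _ : UnitAddTorus d => e) x = fun _ => e := rfl
  simp [FunctionSpaces.Torus.convect, FunctionSpaces.Torus.fderiv, h]

/-- Time derivative of the test field: `∂ₜ(η e)(t,x) = η'(t) e`. [folklore] -/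
theorem timeDeriv_smul_const {d : Type*} [Fintype d] {η : ℝ → ℝ} {t : ℝ}
    (hη : DifferentiableAt ℝ η t) (e : EuclideanSpace ℝ d) (x : UnitAddTorus d) :
    FunctionSpaces.Torus.timeDeriv (fun s (_ : UnitAddTorus d) => η s • e) t x = deriv η t • e := by
  simp only [FunctionSpaces.Torus.timeDeriv]
  exact deriv_smul_const hη e

end TestField

/-! ## The spatial mean of a weak Euler solution is a.e. constant in time -/

section Mean

/-- A field that is (a.e. strongly) measurable on `(0,T) × T^d` with `∫_{(0,T)} ∫ ‖u‖² < ∞` is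
integrable on `(0,T) × T^d` (finite measure). [folklore] -/
theorem integrable_uncurry_prod {d : Type*} [Fintype d] {T : ℝ}
    {u : ℝ → UnitAddTorus d → EuclideanSpace ℝ d}
    (hm : AEStronglyMeasurable (FunctionSpaces.Torus.stLift u) (volume.restrict (Ioo 0 T ×ˢ univ)))
    (h2 : ∫⁻ t in Ioo 0 T, ∫⁻ x, ‖u t x‖ₑ ^ 2 < ⊤) :
    Integrable (uncurry u) ((volume.restrict (Ioo 0 T)).prod volume) := by
  have hm' := FunctionSpaces.Torus.aestronglyMeasurable_uncurry_of_stLift_restrict hm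
  rw [Measure.volume_eq_prod, ← Measure.prod_restrict, Measure.restrict_univ] at hm'
  have hmem : MemLp (uncurry u) 2 ((volume.restrict (Ioo 0 T)).prod volume) := by
    refine ⟨hm', ?_⟩
    rw [← FunctionSpaces.lintegral_rpow_two_eq_eLpNorm]
    refine ENNReal.rpow_lt_top_of_nonneg (by norm_num) (ne_of_lt ?_)
    rw [lintegral_prod _ (hm'.enorm.pow_const _)]
    simpa only [uncurry_apply_pair, ENNReal.rpow_two] using h2
  exact hmem.integrable one_le_two

/-- **The spatial mean of a weak Euler solution is a.e. constant in time.** For a weak solution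
`u` of incompressible Euler on `T^d × (0,T)` and every coordinate `i`, the mean
`t ↦ ∫_{T^d} uᵢ(t,x) dx` is a.e. equal to a constant on `(0,T)`: testing the weak formulation
with `ψ(t,x) = η(t) eᵢ` (smooth, divergence free, `(u·∇)ψ = 0`) gives `∫ η' (∫ uᵢ) = 0` for all
`η ∈ C_c^∞(0,T)`, and `Literature.Analysis.FunctionSpaces.ae_eq_const_of_forall_setIntegral_deriv_mul_eq_zero` concludes
(conservation of total momentum). [folklore] -/
theorem exists_ae_integral_apply_eq_const {d : Type*} [Fintype d] [DecidableEq d] {T : ℝ}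
    (hT : 0 < T) {u : ℝ → UnitAddTorus d → EuclideanSpace ℝ d}
    (hu : FunctionSpaces.Torus.IsWeakEulerSolutionOn T u) (i : d) :
    ∃ c : ℝ, ∀ᵐ t ∂(volume.restrict (Ioo 0 T)), ∫ x, u t x i = c := by
  refine FunctionSpaces.ae_eq_const_of_forall_setIntegral_deriv_mul_eq_zero ?_
    fun η hη hηc hηs => ?_
  · -- integrability of the coordinate mean on `(0,T)`
    have hI := ((EuclideanSpace.proj i : EuclideanSpace ℝ d →L[ℝ] ℝ).integrable_comp
      (integrable_uncurry_prod hu.1 hu.2.1)).integral_prod_left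
    simpa [IntegrableOn] using hI
  · -- the weak formulation tested with `η(t) eᵢ`
    have hw := hu.2.2.2 (fun t _ => η t • EuclideanSpace.single i 1)
      (isSpaceTimeTestIoo_smul_const hT hη hηc hηs _) (fun t => isDivFree_const _)
    refine Eq.trans (integral_congr_ae (Eventually.of_forall fun t => ?_)) hw
    have hd : DifferentiableAt ℝ η t := (hη.differentiable (by simp)).differentiableAt
    simp only [timeDeriv_smul_const hd, convect_const, inner_zero_right, add_zero, zero_mul,
      real_inner_smul_right, EuclideanSpace.inner_single_right, one_mul, RCLike.conj_to_real]
    exact (integral_const_mul _ _).symm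

end Mean

/-! ## Onsager's uniform Hölder condition puts a weak Euler solution in `L³_t C^n_x` -/

section HolderClass

/-- **Onsager's condition (26) implies `u ∈ L³(0,T; C^n(T³))`.** A weak Euler solution on
`T³ × (0,T)`, `T > 0`, obeying `HolderWith C n (u t)` for all `t ∈ (0,T)` with one constant `C`
and `n > 0` belongs to `Literature.Analysis.FunctionSpaces.MemLpHolder 3 n u (Ioo 0 T)`: every slice is in `C^{0,n}_b(T³)`
(Hölder on a compact space), and for a.e. `t` the norm `‖u t‖_∞ + [u t]_n` is bounded by
`‖m‖ + C diam(T³)ⁿ + C`, `m` the (a.e. constant) spatial mean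
(`exists_ae_integral_apply_eq_const`), since `u(t,x) - m = ∫ (u(t,x) - u(t,y)) dy`. [folklore] -/
theorem memLpHolder_of_uniformHolderOn {T : ℝ} (hT : 0 < T) {n : ℝ≥0} (hn : 0 < n)
    {u : ℝ → UnitAddTorus (Fin 3) → EuclideanSpace ℝ (Fin 3)} (hu : IsWeakEulerSolution T u)
    (hH : UniformHolderOn (Ioo 0 T) n u) :
    FunctionSpaces.MemLpHolder 3 n u (Ioo 0 T) := by
  obtain ⟨C, hC⟩ := hH
  refine ⟨?_, ?_⟩
  · filter_upwards [ae_restrict_mem measurableSet_Ioo] with t ht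
    exact MemHolder.memBoundedHolder_of_compactSpace ⟨C, hC t ht⟩ hn
  -- the coordinate means are a.e. constant
  have hmean : ∀ i, ∃ c : ℝ, ∀ᵐ t ∂(volume.restrict (Ioo 0 T)), ∫ x, u t x i = c :=
    fun i => exists_ae_integral_apply_eq_const hT hu i
  choose c hc using hmean
  set m : EuclideanSpace ℝ (Fin 3) := WithLp.toLp 2 c
  set D : ℝ := Metric.diam (univ : Set (UnitAddTorus (Fin 3)))
  set K : ℝ := ‖m‖ + C * D ^ (n : ℝ)
  have hK0 : 0 ≤ K := by positivity
  -- a.e. in time, the bounded Hölder norm of the slice is at most `K + C`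
  have hbound : ∀ᵐ t ∂(volume.restrict (Ioo 0 T)),
      ‖FunctionSpaces.boundedHolderNorm n (u t)‖ ≤ K + C := by
    filter_upwards [ae_restrict_mem measurableSet_Ioo, ae_all_iff.2 hc] with t ht hct
    have hHt : HolderWith C n (u t) := hC t ht
    have hcont : Continuous (u t) := hHt.continuous hn
    have hint : Integrable (u t) volume :=
      hcont.integrable_of_hasCompactSupport (HasCompactSupport.of_compactSpace _)
    -- the mean of the slice is `m`
    have hmt : ∫ x, u t x = m := by
      ext i
      change (∫ x, u t x) i = c i
      rw [← hct i]
      simpa using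
        ((EuclideanSpace.proj i : EuclideanSpace ℝ (Fin 3) →L[ℝ] ℝ).integral_comp_comm hint).symm
    -- oscillation bound
    have hosc : ∀ x y, ‖u t x - u t y‖ ≤ C * D ^ (n : ℝ) := fun x y => by
      rw [← dist_eq_norm]
      exact hHt.dist_le_of_le
        (Metric.dist_le_diam_of_mem isCompact_univ.isBounded (mem_univ x) (mem_univ y))
    -- pointwise bound
    have hpt : ∀ x, ‖u t x‖ ≤ K := fun x => by
      have h1 : u t x - m = ∫ y, (u t x - u t y) := by
        rw [integral_sub (integrable_const _) hint, integral_const, hmt]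
        simp
      have h2 : ‖u t x - m‖ ≤ C * D ^ (n : ℝ) := by
        rw [h1]
        have h3 := norm_integral_le_of_norm_le_const (μ := (volume : Measure (UnitAddTorus (Fin 3))))
          (Eventually.of_forall fun y => hosc x y)
        simpa using h3
      calc ‖u t x‖ = ‖m + (u t x - m)‖ := by rw [add_sub_cancel]
        _ ≤ ‖m‖ + ‖u t x - m‖ := norm_add_le _ _
        _ ≤ ‖m‖ + C * D ^ (n : ℝ) := by gcongr
    -- the extended norms
    have hsup : FunctionSpaces.eSupNorm (u t) ≤ ENNReal.ofReal K := by
      refine iSup_le fun x => ?_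
      rw [← ofReal_norm]
      exact ENNReal.ofReal_le_ofReal (hpt x)
    have hfin : FunctionSpaces.eBoundedHolderNorm n (u t) ≤ ENNReal.ofReal K + C :=
      add_le_add hsup hHt.eHolderNorm_le
    have hne : ENNReal.ofReal K + (C : ℝ≥0∞) ≠ ⊤ :=
      ENNReal.add_ne_top.2 ⟨ENNReal.ofReal_ne_top, ENNReal.coe_ne_top⟩
    rw [FunctionSpaces.boundedHolderNorm, Real.norm_of_nonneg ENNReal.toReal_nonneg]
    calc (FunctionSpaces.eBoundedHolderNorm n (u t)).toReal
        ≤ (ENNReal.ofReal K + (C : ℝ≥0∞)).toReal := ENNReal.toReal_mono hne hfin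
      _ = K + C := by
          rw [ENNReal.toReal_add ENNReal.ofReal_ne_top ENNReal.coe_ne_top,
            ENNReal.toReal_ofReal hK0, ENNReal.coe_toReal]
  -- hence the `L³_t C^n_x` norm is finite
  calc FunctionSpaces.eLpHolderNorm 3 n u (Ioo 0 T)
      ≤ eLpNorm (fun _ : ℝ => K + C) 3 (volume.restrict (Ioo 0 T)) := eLpNorm_mono_ae_real hbound
    _ < ⊤ := (memLp_const (K + (C : ℝ))).eLpNorm_lt_top

end HolderClass

end Onsager1949

/-! ## The discharge -/

section Claims

/-- **Discharge of `Onsager1949_energyConservation` (Onsager 1949, condition (26) and closing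
paragraph; proved in print by Constantin–E–Titi 1994, Theorem p. 207 with the remark on Hölder
spaces following it, and Eyink 1994).** A weak solution of incompressible Euler on `T³ × (0,T)`
obeying Onsager's uniform Hölder condition (26) of some order `n > 1/3` conserves kinetic energy
(a.e. in time). Proof: by `Onsager1949.memLpHolder_of_uniformHolderOn` the solution lies in
`L³(0,T; C^n(T³))`, and the Hölder form of Onsager rigidity
(`onsager_rigidity_holder_of' onsager_rigidity_holds`, Constantin–E–Titi) applies.
[cite: Onsager1949, eq. (26) and closing paragraph] -/
theorem Onsager1949_energyConservation_holds : Onsager1949_energyConservation := by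
  intro T n hn u hu hH
  rcases le_or_gt T 0 with hT | hT
  · simp only [ConservesEnergyAEOn, Ioo_eq_empty_of_le hT, Measure.restrict_empty, ae_zero]
    exact eventually_bot
  have hn0 : 0 < n := lt_trans (by norm_num) hn
  exact onsager_rigidity_holder_of' onsager_rigidity_holds hn u hu
    (Onsager1949.memLpHolder_of_uniformHolderOn hT hn0 hu hH)

end Claims

end Literature.Analysis.FluidPDE
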